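import Mathlib.Data.Nat.Choose.Basic
import Mathlib.Algebra.BigOperators.Intervals
import Mathlib.Algebra.Order.BigOperators.Group.Finset
import Mathlib.Tactic
import Summits.CriticalPhenomena.PercolationContinuityZ3.Theorems.PercNearOneGluingNoHeavyLowerTailULCSmallJ
import HarnessLib

/-!
# THEOREM U-LC for shifts `j = 5, …, 8`: bases `L₀ = j² - 3` by kernel decision

Support file for the Sahi / Conjecture-P programme of route `PercNearOneGluingNoHeavy`
(`--supports stmt-CriticalPhenomena-4575`, prover prim-l12-p5 gen 28; proof note
`prim-l12-p5/U-STRUCTURE-g28.md` §3, §6).  No definitions, no named facts, no sorries.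

Sequel of `…LowerTailULCSmallJ`: the two-point log-concavity of the two-bump sequence
`Φ_j^{(L)}(t) = C(L,t) + C(L,t-j)` propagates from `L` to `L+1` (`ULCSmallJ.phi_lc2_of_base`), so it holds
for all `L ≥ L₀` once checked at the base `L₀ = j² - 3` (the exact threshold: `Φ_j^{(L)}` is log-concave iff
`j² ≤ L+3`).  Here the bases for `j = 5, 6, 7, 8` (`L₀ = 22, 33, 46, 61`) are decided by the kernel, giving
THEOREM U-LC — CONJECTURE U, hence the tilted TEST(j) inequality, for all symmetric unimodal tilts —
unconditionally for `j ≤ 8` throughout the regime `L ≥ j² - 3`: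
`u_lc_kappa_five` (`L ≥ 22`), `u_lc_kappa_six` (`L ≥ 33`), `u_lc_kappa_seven` (`L ≥ 46`), `u_lc_kappa_eight`
(`L ≥ 61`).  (The `decide` calls need a raised `maxRecDepth`; each runs in about a second.)
-/

namespace Summit.CriticalPhenomena.PercolationContinuityZ3.Theorems

namespace ULCMidJ

open Finset

set_option maxRecDepth 100000 in
/-- Base `j = 5`, `L₀ = 22`, finite part, decided by the kernel. -/
theorem phi_lc2_five_fin : ∀ m, m < 27 → ∀ m', m' < 27 → m ≤ m' →
    ((22 : ℕ).choose m + (if 5 ≤ m then (22 : ℕ).choose (m - 5) else 0)) *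
        ((22 : ℕ).choose (m' + 1) + (if 5 ≤ m' + 1 then (22 : ℕ).choose (m' + 1 - 5) else 0)) ≤
      ((22 : ℕ).choose (m + 1) + (if 5 ≤ m + 1 then (22 : ℕ).choose (m + 1 - 5) else 0)) *
        ((22 : ℕ).choose m' + (if 5 ≤ m' then (22 : ℕ).choose (m' - 5) else 0)) := by
  decide

/-- Base `j = 5`, `L₀ = 22`: `Φ_5^{(22)}` is two-point log-concave (over `ℕ`). -/
theorem phi_lc2_five_base : ∀ m m', m ≤ m' →
    ((22 : ℕ).choose m + (if 5 ≤ m then (22 : ℕ).choose (m - 5) else 0)) *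
        ((22 : ℕ).choose (m' + 1) + (if 5 ≤ m' + 1 then (22 : ℕ).choose (m' + 1 - 5) else 0)) ≤
      ((22 : ℕ).choose (m + 1) + (if 5 ≤ m + 1 then (22 : ℕ).choose (m + 1 - 5) else 0)) *
        ((22 : ℕ).choose m' + (if 5 ≤ m' then (22 : ℕ).choose (m' - 5) else 0)) := by
  intro m m' hmm'
  rcases le_or_gt (22 + 5) m' with hbig | hsmall
  · exact ULCSmallJ.phi_lc2_nat_large 22 5 m m' hbig
  · exact phi_lc2_five_fin m (by omega) m' (by omega) hmm'

/-- `Φ_5^{(L)}` is two-point log-concave for `L ≥ 22`. -/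
theorem phi_lc2_five (L : ℕ) (hL : 22 ≤ L) (m m' : ℕ) (h : m ≤ m') :
    ((L.choose m : ℝ) + (if 5 ≤ m then (L.choose (m - 5) : ℝ) else 0)) *
        ((L.choose (m' + 1) : ℝ) + (if 5 ≤ m' + 1 then (L.choose (m' + 1 - 5) : ℝ) else 0)) ≤
      ((L.choose (m + 1) : ℝ) + (if 5 ≤ m + 1 then (L.choose (m + 1 - 5) : ℝ) else 0)) *
        ((L.choose m' : ℝ) + (if 5 ≤ m' then (L.choose (m' - 5) : ℝ) else 0)) :=
  ULCSmallJ.phi_lc2_of_base 22 5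
    (fun a b hab => ULCSmallJ.phi_lc2_real_of_nat 22 5 phi_lc2_five_base a b hab)
    (L - 22) L (by omega) m m' h

/-- **THEOREM U-LC for `j = 5` (unconditional, `L ≥ 22`).**  With `2K + 5 = M₁+M₂+L`, `κ ≥ 0`,
`κ N(N-1) ≥ M₁M₂(N-25)` and symmetric unimodal tilts, the tilted two-block sum is nonnegative
(the tilted TEST(5) inequality). -/
theorem u_lc_kappa_five (M₁ M₂ L K : ℕ) (hL : 22 ≤ L) (hN : 2 * K + 5 = M₁ + M₂ + L) (κ : ℝ)
    (hκ : 0 ≤ κ)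
    (hκ₀ : (M₁ : ℝ) * M₂ * (((M₁ + M₂ + L : ℕ) : ℝ) - (((M₁ + M₂ + L : ℕ) : ℝ) - 2 * K) ^ 2) ≤
      κ * (((M₁ + M₂ + L : ℕ) : ℝ) * (((M₁ + M₂ + L : ℕ) : ℝ) - 1)))
    (w₁ w₂ : ℕ → ℝ) (hw₁nn : ∀ x, 0 ≤ w₁ x)
    (hw₁sym : ∀ x, x ≤ M₁ → w₁ x = w₁ (M₁ - x)) (hw₁uni : ∀ x, 2 * x + 2 ≤ M₁ → w₁ x ≤ w₁ (x + 1))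
    (hw₂nn : ∀ x, 0 ≤ w₂ x)
    (hw₂sym : ∀ x, x ≤ M₂ → w₂ x = w₂ (M₂ - x)) (hw₂uni : ∀ x, 2 * x + 2 ≤ M₂ → w₂ x ≤ w₂ (x + 1)) :
    0 ≤ ∑ x₁ ∈ range (M₁ + 1), ∑ x₂ ∈ range (M₂ + 1),
        (M₁.choose x₁ : ℝ) * w₁ x₁ * ((M₂.choose x₂ : ℝ) * w₂ x₂) *
          (if x₁ + x₂ ≤ K then (L.choose (K - (x₁ + x₂)) : ℝ) else 0) *
          (κ + (2 * (x₁ : ℝ) - M₁) * (2 * (x₂ : ℝ) - M₂)) :=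
  ULCKappa.u_lc_kappa M₁ M₂ L K 5 hN κ hκ hκ₀ w₁ w₂ hw₁nn hw₁sym hw₁uni hw₂nn hw₂sym hw₂uni
    (fun m m' h => phi_lc2_five L hL m m' h)

set_option maxRecDepth 100000 in
/-- Base `j = 6`, `L₀ = 33`, finite part, decided by the kernel. -/
theorem phi_lc2_six_fin : ∀ m, m < 39 → ∀ m', m' < 39 → m ≤ m' →
    ((33 : ℕ).choose m + (if 6 ≤ m then (33 : ℕ).choose (m - 6) else 0)) *
        ((33 : ℕ).choose (m' + 1) + (if 6 ≤ m' + 1 then (33 : ℕ).choose (m' + 1 - 6) else 0)) ≤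
      ((33 : ℕ).choose (m + 1) + (if 6 ≤ m + 1 then (33 : ℕ).choose (m + 1 - 6) else 0)) *
        ((33 : ℕ).choose m' + (if 6 ≤ m' then (33 : ℕ).choose (m' - 6) else 0)) := by
  decide

/-- Base `j = 6`, `L₀ = 33`: `Φ_6^{(33)}` is two-point log-concave (over `ℕ`). -/
theorem phi_lc2_six_base : ∀ m m', m ≤ m' →
    ((33 : ℕ).choose m + (if 6 ≤ m then (33 : ℕ).choose (m - 6) else 0)) *
        ((33 : ℕ).choose (m' + 1) + (if 6 ≤ m' + 1 then (33 : ℕ).choose (m' + 1 - 6) else 0)) ≤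
      ((33 : ℕ).choose (m + 1) + (if 6 ≤ m + 1 then (33 : ℕ).choose (m + 1 - 6) else 0)) *
        ((33 : ℕ).choose m' + (if 6 ≤ m' then (33 : ℕ).choose (m' - 6) else 0)) := by
  intro m m' hmm'
  rcases le_or_gt (33 + 6) m' with hbig | hsmall
  · exact ULCSmallJ.phi_lc2_nat_large 33 6 m m' hbig
  · exact phi_lc2_six_fin m (by omega) m' (by omega) hmm'

/-- `Φ_6^{(L)}` is two-point log-concave for `L ≥ 33`. -/
theorem phi_lc2_six (L : ℕ) (hL : 33 ≤ L) (m m' : ℕ) (h : m ≤ m') :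
    ((L.choose m : ℝ) + (if 6 ≤ m then (L.choose (m - 6) : ℝ) else 0)) *
        ((L.choose (m' + 1) : ℝ) + (if 6 ≤ m' + 1 then (L.choose (m' + 1 - 6) : ℝ) else 0)) ≤
      ((L.choose (m + 1) : ℝ) + (if 6 ≤ m + 1 then (L.choose (m + 1 - 6) : ℝ) else 0)) *
        ((L.choose m' : ℝ) + (if 6 ≤ m' then (L.choose (m' - 6) : ℝ) else 0)) :=
  ULCSmallJ.phi_lc2_of_base 33 6
    (fun a b hab => ULCSmallJ.phi_lc2_real_of_nat 33 6 phi_lc2_six_base a b hab)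
    (L - 33) L (by omega) m m' h

/-- **THEOREM U-LC for `j = 6` (unconditional, `L ≥ 33`).**  With `2K + 6 = M₁+M₂+L`, `κ ≥ 0`,
`κ N(N-1) ≥ M₁M₂(N-36)` and symmetric unimodal tilts, the tilted two-block sum is nonnegative
(the tilted TEST(6) inequality). -/
theorem u_lc_kappa_six (M₁ M₂ L K : ℕ) (hL : 33 ≤ L) (hN : 2 * K + 6 = M₁ + M₂ + L) (κ : ℝ)
    (hκ : 0 ≤ κ)
    (hκ₀ : (M₁ : ℝ) * M₂ * (((M₁ + M₂ + L : ℕ) : ℝ) - (((M₁ + M₂ + L : ℕ) : ℝ) - 2 * K) ^ 2) ≤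
      κ * (((M₁ + M₂ + L : ℕ) : ℝ) * (((M₁ + M₂ + L : ℕ) : ℝ) - 1)))
    (w₁ w₂ : ℕ → ℝ) (hw₁nn : ∀ x, 0 ≤ w₁ x)
    (hw₁sym : ∀ x, x ≤ M₁ → w₁ x = w₁ (M₁ - x)) (hw₁uni : ∀ x, 2 * x + 2 ≤ M₁ → w₁ x ≤ w₁ (x + 1))
    (hw₂nn : ∀ x, 0 ≤ w₂ x)
    (hw₂sym : ∀ x, x ≤ M₂ → w₂ x = w₂ (M₂ - x)) (hw₂uni : ∀ x, 2 * x + 2 ≤ M₂ → w₂ x ≤ w₂ (x + 1)) :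
    0 ≤ ∑ x₁ ∈ range (M₁ + 1), ∑ x₂ ∈ range (M₂ + 1),
        (M₁.choose x₁ : ℝ) * w₁ x₁ * ((M₂.choose x₂ : ℝ) * w₂ x₂) *
          (if x₁ + x₂ ≤ K then (L.choose (K - (x₁ + x₂)) : ℝ) else 0) *
          (κ + (2 * (x₁ : ℝ) - M₁) * (2 * (x₂ : ℝ) - M₂)) :=
  ULCKappa.u_lc_kappa M₁ M₂ L K 6 hN κ hκ hκ₀ w₁ w₂ hw₁nn hw₁sym hw₁uni hw₂nn hw₂sym hw₂uni
    (fun m m' h => phi_lc2_six L hL m m' h)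

set_option maxRecDepth 100000 in
/-- Base `j = 7`, `L₀ = 46`, finite part, decided by the kernel. -/
theorem phi_lc2_seven_fin : ∀ m, m < 53 → ∀ m', m' < 53 → m ≤ m' →
    ((46 : ℕ).choose m + (if 7 ≤ m then (46 : ℕ).choose (m - 7) else 0)) *
        ((46 : ℕ).choose (m' + 1) + (if 7 ≤ m' + 1 then (46 : ℕ).choose (m' + 1 - 7) else 0)) ≤
      ((46 : ℕ).choose (m + 1) + (if 7 ≤ m + 1 then (46 : ℕ).choose (m + 1 - 7) else 0)) *
        ((46 : ℕ).choose m' + (if 7 ≤ m' then (46 : ℕ).choose (m' - 7) else 0)) := by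
  decide

/-- Base `j = 7`, `L₀ = 46`: `Φ_7^{(46)}` is two-point log-concave (over `ℕ`). -/
theorem phi_lc2_seven_base : ∀ m m', m ≤ m' →
    ((46 : ℕ).choose m + (if 7 ≤ m then (46 : ℕ).choose (m - 7) else 0)) *
        ((46 : ℕ).choose (m' + 1) + (if 7 ≤ m' + 1 then (46 : ℕ).choose (m' + 1 - 7) else 0)) ≤
      ((46 : ℕ).choose (m + 1) + (if 7 ≤ m + 1 then (46 : ℕ).choose (m + 1 - 7) else 0)) *
        ((46 : ℕ).choose m' + (if 7 ≤ m' then (46 : ℕ).choose (m' - 7) else 0)) := by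
  intro m m' hmm'
  rcases le_or_gt (46 + 7) m' with hbig | hsmall
  · exact ULCSmallJ.phi_lc2_nat_large 46 7 m m' hbig
  · exact phi_lc2_seven_fin m (by omega) m' (by omega) hmm'

/-- `Φ_7^{(L)}` is two-point log-concave for `L ≥ 46`. -/
theorem phi_lc2_seven (L : ℕ) (hL : 46 ≤ L) (m m' : ℕ) (h : m ≤ m') :
    ((L.choose m : ℝ) + (if 7 ≤ m then (L.choose (m - 7) : ℝ) else 0)) *
        ((L.choose (m' + 1) : ℝ) + (if 7 ≤ m' + 1 then (L.choose (m' + 1 - 7) : ℝ) else 0)) ≤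
      ((L.choose (m + 1) : ℝ) + (if 7 ≤ m + 1 then (L.choose (m + 1 - 7) : ℝ) else 0)) *
        ((L.choose m' : ℝ) + (if 7 ≤ m' then (L.choose (m' - 7) : ℝ) else 0)) :=
  ULCSmallJ.phi_lc2_of_base 46 7
    (fun a b hab => ULCSmallJ.phi_lc2_real_of_nat 46 7 phi_lc2_seven_base a b hab)
    (L - 46) L (by omega) m m' h

/-- **THEOREM U-LC for `j = 7` (unconditional, `L ≥ 46`).**  With `2K + 7 = M₁+M₂+L`, `κ ≥ 0`,
`κ N(N-1) ≥ M₁M₂(N-49)` and symmetric unimodal tilts, the tilted two-block sum is nonnegative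
(the tilted TEST(7) inequality). -/
theorem u_lc_kappa_seven (M₁ M₂ L K : ℕ) (hL : 46 ≤ L) (hN : 2 * K + 7 = M₁ + M₂ + L) (κ : ℝ)
    (hκ : 0 ≤ κ)
    (hκ₀ : (M₁ : ℝ) * M₂ * (((M₁ + M₂ + L : ℕ) : ℝ) - (((M₁ + M₂ + L : ℕ) : ℝ) - 2 * K) ^ 2) ≤
      κ * (((M₁ + M₂ + L : ℕ) : ℝ) * (((M₁ + M₂ + L : ℕ) : ℝ) - 1)))
    (w₁ w₂ : ℕ → ℝ) (hw₁nn : ∀ x, 0 ≤ w₁ x)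
    (hw₁sym : ∀ x, x ≤ M₁ → w₁ x = w₁ (M₁ - x)) (hw₁uni : ∀ x, 2 * x + 2 ≤ M₁ → w₁ x ≤ w₁ (x + 1))
    (hw₂nn : ∀ x, 0 ≤ w₂ x)
    (hw₂sym : ∀ x, x ≤ M₂ → w₂ x = w₂ (M₂ - x)) (hw₂uni : ∀ x, 2 * x + 2 ≤ M₂ → w₂ x ≤ w₂ (x + 1)) :
    0 ≤ ∑ x₁ ∈ range (M₁ + 1), ∑ x₂ ∈ range (M₂ + 1),
        (M₁.choose x₁ : ℝ) * w₁ x₁ * ((M₂.choose x₂ : ℝ) * w₂ x₂) *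
          (if x₁ + x₂ ≤ K then (L.choose (K - (x₁ + x₂)) : ℝ) else 0) *
          (κ + (2 * (x₁ : ℝ) - M₁) * (2 * (x₂ : ℝ) - M₂)) :=
  ULCKappa.u_lc_kappa M₁ M₂ L K 7 hN κ hκ hκ₀ w₁ w₂ hw₁nn hw₁sym hw₁uni hw₂nn hw₂sym hw₂uni
    (fun m m' h => phi_lc2_seven L hL m m' h)

set_option maxRecDepth 100000 in
/-- Base `j = 8`, `L₀ = 61`, finite part, decided by the kernel. -/
theorem phi_lc2_eight_fin : ∀ m, m < 69 → ∀ m', m' < 69 → m ≤ m' →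
    ((61 : ℕ).choose m + (if 8 ≤ m then (61 : ℕ).choose (m - 8) else 0)) *
        ((61 : ℕ).choose (m' + 1) + (if 8 ≤ m' + 1 then (61 : ℕ).choose (m' + 1 - 8) else 0)) ≤
      ((61 : ℕ).choose (m + 1) + (if 8 ≤ m + 1 then (61 : ℕ).choose (m + 1 - 8) else 0)) *
        ((61 : ℕ).choose m' + (if 8 ≤ m' then (61 : ℕ).choose (m' - 8) else 0)) := by
  decide

/-- Base `j = 8`, `L₀ = 61`: `Φ_8^{(61)}` is two-point log-concave (over `ℕ`). -/
theorem phi_lc2_eight_base : ∀ m m', m ≤ m' →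
    ((61 : ℕ).choose m + (if 8 ≤ m then (61 : ℕ).choose (m - 8) else 0)) *
        ((61 : ℕ).choose (m' + 1) + (if 8 ≤ m' + 1 then (61 : ℕ).choose (m' + 1 - 8) else 0)) ≤
      ((61 : ℕ).choose (m + 1) + (if 8 ≤ m + 1 then (61 : ℕ).choose (m + 1 - 8) else 0)) *
        ((61 : ℕ).choose m' + (if 8 ≤ m' then (61 : ℕ).choose (m' - 8) else 0)) := by
  intro m m' hmm'
  rcases le_or_gt (61 + 8) m' with hbig | hsmall
  · exact ULCSmallJ.phi_lc2_nat_large 61 8 m m' hbig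
  · exact phi_lc2_eight_fin m (by omega) m' (by omega) hmm'

/-- `Φ_8^{(L)}` is two-point log-concave for `L ≥ 61`. -/
theorem phi_lc2_eight (L : ℕ) (hL : 61 ≤ L) (m m' : ℕ) (h : m ≤ m') :
    ((L.choose m : ℝ) + (if 8 ≤ m then (L.choose (m - 8) : ℝ) else 0)) *
        ((L.choose (m' + 1) : ℝ) + (if 8 ≤ m' + 1 then (L.choose (m' + 1 - 8) : ℝ) else 0)) ≤
      ((L.choose (m + 1) : ℝ) + (if 8 ≤ m + 1 then (L.choose (m + 1 - 8) : ℝ) else 0)) *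
        ((L.choose m' : ℝ) + (if 8 ≤ m' then (L.choose (m' - 8) : ℝ) else 0)) :=
  ULCSmallJ.phi_lc2_of_base 61 8
    (fun a b hab => ULCSmallJ.phi_lc2_real_of_nat 61 8 phi_lc2_eight_base a b hab)
    (L - 61) L (by omega) m m' h

/-- **THEOREM U-LC for `j = 8` (unconditional, `L ≥ 61`).**  With `2K + 8 = M₁+M₂+L`, `κ ≥ 0`,
`κ N(N-1) ≥ M₁M₂(N-64)` and symmetric unimodal tilts, the tilted two-block sum is nonnegative
(the tilted TEST(8) inequality). -/
theorem u_lc_kappa_eight (M₁ M₂ L K : ℕ) (hL : 61 ≤ L) (hN : 2 * K + 8 = M₁ + M₂ + L) (κ : ℝ)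
    (hκ : 0 ≤ κ)
    (hκ₀ : (M₁ : ℝ) * M₂ * (((M₁ + M₂ + L : ℕ) : ℝ) - (((M₁ + M₂ + L : ℕ) : ℝ) - 2 * K) ^ 2) ≤
      κ * (((M₁ + M₂ + L : ℕ) : ℝ) * (((M₁ + M₂ + L : ℕ) : ℝ) - 1)))
    (w₁ w₂ : ℕ → ℝ) (hw₁nn : ∀ x, 0 ≤ w₁ x)
    (hw₁sym : ∀ x, x ≤ M₁ → w₁ x = w₁ (M₁ - x)) (hw₁uni : ∀ x, 2 * x + 2 ≤ M₁ → w₁ x ≤ w₁ (x + 1))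
    (hw₂nn : ∀ x, 0 ≤ w₂ x)
    (hw₂sym : ∀ x, x ≤ M₂ → w₂ x = w₂ (M₂ - x)) (hw₂uni : ∀ x, 2 * x + 2 ≤ M₂ → w₂ x ≤ w₂ (x + 1)) :
    0 ≤ ∑ x₁ ∈ range (M₁ + 1), ∑ x₂ ∈ range (M₂ + 1),
        (M₁.choose x₁ : ℝ) * w₁ x₁ * ((M₂.choose x₂ : ℝ) * w₂ x₂) *
          (if x₁ + x₂ ≤ K then (L.choose (K - (x₁ + x₂)) : ℝ) else 0) *
          (κ + (2 * (x₁ : ℝ) - M₁) * (2 * (x₂ : ℝ) - M₂)) :=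
  ULCKappa.u_lc_kappa M₁ M₂ L K 8 hN κ hκ hκ₀ w₁ w₂ hw₁nn hw₁sym hw₁uni hw₂nn hw₂sym hw₂uni
    (fun m m' h => phi_lc2_eight L hL m m' h)

end ULCMidJ

end Summit.CriticalPhenomena.PercolationContinuityZ3.Theorems
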